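import Mathlib
import HarnessLib
import Summits.NavierStokesRegularity.NavierStokesRegularity.Theorems.TaylorModelRungThreeCertificateFormat
import Summits.NavierStokesRegularity.NavierStokesRegularity.Theorems.TaylorModelRungThreeCertificateSoundBridge
import Summits.NavierStokesRegularity.NavierStokesRegularity.Theorems.TaylorModelRungThreeCertificateSoundField
import Summits.NavierStokesRegularity.NavierStokesRegularity.Theorems.TaylorModelRungThreeCertificateSoundNode

/-!
# Crux K1b-DR (stmt-NavierStokesRegularity-23954), line `taylor-model` — certificate SOUNDNESS, part 4: the SUB-STEP
# clauses of `Chain` from `checkStep = true`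

`CertTables.step_of_checkStep`: for an exact ordered field `K`, a monotone ring map `φ : K →+* ℝ` and tables `T`, a
sub-step `(j, s)` with `T.checkStep j s = true` satisfies the twenty-three per-sub-step clauses b1–b23 of
`TaylorChain.CertData.Chain` for the interpreted record `T.toCertData φ` VERBATIM: positivity of `h` and the three
majorant-convergence guards, `Tn (s+1) = Tn s + h`, the Taylor-polynomial bound `|TP u| ≤ mT ω` on `[0, h]` (from
`Σ |P n| h^n`), the `L1` clause, the two variational bounds `NV` / `NVh` (weighted row sums of the `W n`, resp. of
`Σ h^n W n`), the centre-defect bound `dP` (exact evaluation), the six majorant inequalities (exact evaluation of `Rem`,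
`RemV`, `Dev` in `K`), the κ-entry, the LOHNER transport clause b21 (row sums of the composite matrix
`Ci' · (Σ h^n W n) · Cm`), the `κB` clause and the window `M`-bounds b23. CERT-CONTRACT-23954 v1 §4 (sub-step block).
MODEL-lattice rung TL-M3; nothing here is a statement about the Navier–Stokes equations.
-/

-- the sub-problem namespace repeats the summit name by design (D-0017)
set_option linter.dupNamespace false

namespace Summit.NavierStokesRegularity.NavierStokesRegularity.Theorems.TaylorModelCert

open scoped BigOperators
open Literature.Analysis.FluidPDE.TaoCascade Literature.Analysis.FluidPDE.TaoCascade.TaylorChain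

namespace CertTables

/-! ### Projections of `toCertData` at a sub-step, and the three majorants under `φ` -/

section Proj

variable {K : Type} [Field K] (φ : K →+* ℝ) (T : CertTables K) (j s : ℕ)

/-- `Tn` of a node. [folklore] -/
theorem toCertData_Tn : (T.toCertData φ).Tn j s = φ (T.node j s).Tn := rfl
/-- `h` of a sub-step. [folklore] -/
theorem toCertData_h : (T.toCertData φ).h j s = φ (T.step j s).h := rfl
/-- `bb` of a stage. [folklore] -/
theorem toCertData_bb : (T.toCertData φ).bb j = φ (T.stage j).bb := rfl
/-- `κ` of a stage. [folklore] -/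
theorem toCertData_κ : (T.toCertData φ).κ j = φ (T.stage j).κ := rfl
/-- `Λ` of a stage. [folklore] -/
theorem toCertData_Λ : (T.toCertData φ).Λ j = φ (T.stage j).Λ := rfl
/-- `δ` of a stage. [folklore] -/
theorem toCertData_δ : (T.toCertData φ).δ j = φ (T.stage j).δ := rfl
/-- `τs`. [folklore] -/
theorem toCertData_τs : (T.toCertData φ).τs = φ T.τs := rfl
/-- `mm`. [folklore] -/
theorem toCertData_mm : (T.toCertData φ).mm = φ T.mm := rfl
/-- `mT` of a sub-step. [folklore] -/
theorem toCertData_mT : (T.toCertData φ).mT j s = φ (T.step j s).mT := rfl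
/-- `SpO` of a sub-step. [folklore] -/
theorem toCertData_SpO : (T.toCertData φ).SpO j s = φ (T.step j s).SpO := rfl
/-- `Sp` of a sub-step. [folklore] -/
theorem toCertData_Sp : (T.toCertData φ).Sp j s = φ (T.step j s).Sp := rfl
/-- `SpI` of a sub-step. [folklore] -/
theorem toCertData_SpI : (T.toCertData φ).SpI j s = φ (T.step j s).SpI := rfl
/-- `L1` of a sub-step. [folklore] -/
theorem toCertData_L1 : (T.toCertData φ).L1 j s = φ (T.step j s).L1 := rfl
/-- `NV` of a sub-step. [folklore] -/
theorem toCertData_NV : (T.toCertData φ).NV j s = φ (T.step j s).NV := rfl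
/-- `NVh` of a sub-step. [folklore] -/
theorem toCertData_NVh : (T.toCertData φ).NVh j s = φ (T.step j s).NVh := rfl
/-- `dP` of a sub-step. [folklore] -/
theorem toCertData_dP : (T.toCertData φ).dP j s = φ (T.step j s).dP := rfl
/-- `κB` of a sub-step. [folklore] -/
theorem toCertData_κB : (T.toCertData φ).κB j s = φ (T.step j s).κB := rfl

/-- `Rem` evaluated exactly. [folklore] -/
theorem map_RemK (b mC u : K) : φ (T.RemK b mC u) = (T.toCertData φ).Rem (φ b) (φ mC) (φ u) := by
  simp [RemK, CertData.Rem, map_div₀, toCertData_pdeg]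

/-- `RemV` evaluated exactly. [folklore] -/
theorem map_RemVK (b mC u : K) : φ (T.RemVK b mC u) = (T.toCertData φ).RemV (φ b) (φ mC) (φ u) := by
  simp [RemVK, CertData.RemV, map_div₀, map_ofNat, toCertData_pdeg]

/-- `Dev` evaluated exactly. [folklore] -/
theorem map_DevK (b mC r u : K) : φ (DevK b mC r u) = CertData.Dev (φ b) (φ mC) (φ r) (φ u) := by
  simp [DevK, CertData.Dev, map_div₀]

/-- Window values of the Taylor polynomial `TP`. [folklore] -/
theorem wv_TP (u : ℝ) {c : ℕ} (hc : c < T.n) : T.wv ((T.toCertData φ).TP j s u) c =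
    ∑ q ∈ Finset.range (T.pdeg + 1), φ (vget ((T.node j s).P.getD q []) c) * u ^ q := by
  show (∑ q ∈ Finset.range ((T.toCertData φ).pdeg + 1), (T.toCertData φ).P j s q (T.wi c) (T.wk c) * u ^ q) = _
  rw [toCertData_pdeg]
  refine Finset.sum_congr rfl fun q _ => ?_
  rw [toCertData_P, show T.vecR φ _ (T.wi c) (T.wk c) = T.wv (T.vecR φ ((T.node j s).P.getD q [])) c from rfl,
    T.wv_vecR φ _ hc]

/-- The variational polynomial at `u = h` is `linR` of `vapMat`. [folklore] -/
theorem Vap_h_eq_linR (v : Fin 4 → ℤ → ℝ) :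
    (T.toCertData φ).Vap j s (φ (T.step j s).h) v = T.linR φ (T.vapMat (T.node j s) (T.step j s).h) v := by
  unfold vapMat
  rw [T.linR_foldr_addMatN φ]
  funext i k
  rw [Finset.sum_apply, Finset.sum_apply]
  show (∑ q ∈ Finset.range ((T.toCertData φ).pdeg + 1), (T.toCertData φ).Wv j s q v i k * (φ (T.step j s).h) ^ q) = _
  rw [toCertData_pdeg]
  refine Finset.sum_congr rfl fun q _ => ?_
  rw [T.linR_smulMatN φ, toCertData_Wv, map_pow, mul_comm]
  simp only [Pi.smul_apply, smul_eq_mul]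

/-- Window values of the variational polynomial `Vap`. [folklore] -/
theorem wv_Vap (u : ℝ) (v : Fin 4 → ℤ → ℝ) (r : ℕ) : T.wv ((T.toCertData φ).Vap j s u v) r =
    ∑ q ∈ Finset.range (T.pdeg + 1), T.wv (T.linR φ ((T.node j s).W.getD q []) v) r * u ^ q := by
  show (∑ q ∈ Finset.range ((T.toCertData φ).pdeg + 1), (T.toCertData φ).Wv j s q v (T.wi r) (T.wk r) * u ^ q) = _
  rw [toCertData_pdeg]
  rfl

/-- The shell envelope `M` of the interpreted record on the window, by coordinate. [folklore] -/
theorem M_of_InW (i : Fin 4) {k : ℤ} (hk : -T.Kb ≤ k ∧ k ≤ T.Ka) :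
    (T.toCertData φ).M k = φ (vget T.M (T.idx i k % T.m + 1)) := by
  rw [T.idx_mod i hk]
  show (if -T.Kb - 1 ≤ k ∧ k ≤ T.Ka + 1 then φ (vget T.M (k + T.Kb + 1).toNat) else 0) = _
  rw [if_pos (by omega)]
  congr 2; omega

end Proj

/-! ### The sub-step clauses -/

section Step

variable {K : Type} [Field K] [LinearOrder K] [IsStrictOrderedRing K] {φ : K →+* ℝ} (hφ : Monotone φ)
  (T : CertTables K)
include hφ

omit [IsStrictOrderedRing K] hφ in
/-- `tpAbs` as a `Finset` sum. [folklore] -/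
theorem tpAbs_eq (N : NodeTables K) (h : K) (c : ℕ) :
    T.tpAbs N h c = ∑ q ∈ Finset.range (T.pdeg + 1), |vget (N.P.getD q []) c| * h ^ q := by
  unfold tpAbs; rw [sumN_eq]

/-- Weighted row sums bound the window values of `linR A y`, with a scale factor on the input box. [folklore] -/
theorem abs_wv_linR_le_mul {A : List (List K)} {wIn bound : ℕ → K} (h : T.rowSumLe A wIn bound = true)
    {y : Fin 4 → ℤ → ℝ} {N : ℝ} (hN : 0 ≤ N) (hy : ∀ c < T.n, |T.wv y c| ≤ N * φ (wIn c)) {r : ℕ} (hr : r < T.n) :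
    |T.wv (T.linR φ A y) r| ≤ N * φ (bound r) := by
  rw [T.wv_linR φ A y hr]
  have hrow := (T.rowSumLe_eq_true.1 h) r hr
  calc |∑ c ∈ Finset.range T.n, φ (mget A r c) * T.wv y c|
      ≤ ∑ c ∈ Finset.range T.n, |φ (mget A r c) * T.wv y c| := Finset.abs_sum_le_sum_abs _ _
    _ ≤ ∑ c ∈ Finset.range T.n, |φ (mget A r c)| * (N * φ (wIn c)) := by
        refine Finset.sum_le_sum fun c hc => ?_
        rw [abs_mul]
        exact mul_le_mul_of_nonneg_left (hy c (Finset.mem_range.1 hc)) (abs_nonneg _)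
    _ = N * φ (∑ c ∈ Finset.range T.n, |mget A r c| * wIn c) := by
        rw [map_sum, Finset.mul_sum]
        exact Finset.sum_congr rfl fun c _ => by rw [map_mul, map_abs hφ]; ring
    _ ≤ N * φ (bound r) := mul_le_mul_of_nonneg_left (hφ hrow) hN

/-- The Taylor polynomial is bounded by `tpAbs` on `[0, h]`, coordinate-wise. [folklore] -/
theorem abs_wv_TP_le (j s : ℕ) {u : ℝ} (hu0 : 0 ≤ u) (huh : u ≤ φ (T.step j s).h) {c : ℕ} (hc : c < T.n) :
    |T.wv ((T.toCertData φ).TP j s u) c| ≤ φ (T.tpAbs (T.node j s) (T.step j s).h c) := by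
  rw [T.wv_TP φ j s u hc, T.tpAbs_eq, map_sum]
  refine (Finset.abs_sum_le_sum_abs _ _).trans (Finset.sum_le_sum fun q _ => ?_)
  rw [abs_mul, map_mul, map_abs hφ, map_pow, abs_pow, abs_of_nonneg hu0]
  exact mul_le_mul_of_nonneg_left (pow_le_pow_left₀ hu0 huh q) (abs_nonneg _)

/-- **Soundness of the sub-step check**: `checkStep = true` gives the per-sub-step clauses b1–b23 of `Chain` for
the interpreted record, verbatim. [folklore] -/
theorem step_of_checkStep {j s : ℕ} (hS : T.checkStep j s = true) {d : CertData}
    (hd : d = T.toCertData φ) :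
    0 < d.h j s ∧ d.bb j * d.mC j s * d.h j s < 1 ∧ d.bb j * (d.mC j s + d.ρO j s) * d.h j s < 1 ∧
      d.Tn j (s + 1) = d.Tn j s + d.h j s ∧
      (∀ u ∈ Set.Icc 0 (d.h j s), d.InBall j (d.TP j s u) (d.mT j s)) ∧ 0 ≤ d.SpO j s ∧
      d.bb j * (d.mT j s + d.SpO j s + d.κ j) * d.h j s < 1 ∧
      1 / (1 - d.bb j * (d.mT j s + d.SpO j s + d.κ j) * d.h j s) ^ 2 ≤ d.L1 j s ∧
      0 ≤ d.NV j s ∧ (∀ u ∈ Set.Icc 0 (d.h j s), ∀ (v : (Fin 4 → ℤ → ℝ)) (N : ℝ), 0 ≤ N → d.InBall j v N →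
        d.InBall j (d.Vap j s u v) (d.NV j s * N)) ∧
      0 ≤ d.NVh j s ∧ (∀ (v : (Fin 4 → ℤ → ℝ)) (N : ℝ), 0 ≤ N → d.InBall j v N →
        d.InBall j (d.Vap j s (d.h j s) v) (d.NVh j s * N)) ∧
      d.InBall j (d.TP j s (d.h j s) - d.x j (s + 1)) (d.dP j s) ∧
      d.NV j s * d.EI j s + d.Rem (d.bb j) (d.mC j s) (d.h j s) + d.RemV (d.bb j) (d.mC j s) (d.h j s) * d.EI j s +
        CertData.Dev (d.bb j) (d.mC j s) (d.EI j s) (d.h j s) ≤ d.SpI j s ∧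
      d.NV j s * d.ρ j s + d.Rem (d.bb j) (d.mC j s) (d.h j s) + d.RemV (d.bb j) (d.mC j s) (d.h j s) * d.ρ j s +
        CertData.Dev (d.bb j) (d.mC j s) (d.ρ j s) (d.h j s) ≤ d.Sp j s ∧
      d.NV j s * d.ρO j s + d.Rem (d.bb j) (d.mC j s) (d.h j s) + d.RemV (d.bb j) (d.mC j s) (d.h j s) * d.ρO j s +
        CertData.Dev (d.bb j) (d.mC j s) (d.ρO j s) (d.h j s) + d.L1 j s * d.κ j ≤ d.SpO j s ∧
      d.dP j s + d.NVh j s * d.EI j s + d.Rem (d.bb j) (d.mC j s) (d.h j s) +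
        d.RemV (d.bb j) (d.mC j s) (d.h j s) * d.EI j s + CertData.Dev (d.bb j) (d.mC j s) (d.EI j s) (d.h j s) ≤
        d.EI j (s + 1) ∧
      d.dP j s + d.NVh j s * d.E j s + d.Rem (d.bb j) (d.mC j s) (d.h j s) +
        d.RemV (d.bb j) (d.mC j s) (d.h j s) * d.ρ j s + CertData.Dev (d.bb j) (d.mC j s) (d.ρ j s) (d.h j s) ≤
        d.E j (s + 1) ∧
      d.dP j s + d.NVh j s * d.EO j s + d.Rem (d.bb j) (d.mC j s) (d.h j s) +
        d.RemV (d.bb j) (d.mC j s) (d.h j s) * d.ρO j s + CertData.Dev (d.bb j) (d.mC j s) (d.ρO j s) (d.h j s) ≤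
        d.EO j (s + 1) ∧
      d.E j (s + 1) + d.L1 j s * d.κ j ≤ d.EO j (s + 1) ∧
      (∀ ξ : (Fin 4 → ℤ → ℝ), (∀ i k, -d.Kb ≤ k → k ≤ d.Ka → |ξ i k| ≤ d.rP j s i k) → ∀ i k, -d.Kb ≤ k → k ≤ d.Ka →
        |d.Ci j (s + 1) (d.Vap j s (d.h j s) (d.Cm j s ξ)) i k| ≤ d.rP j (s + 1) i k) ∧
      d.NCi j (s + 1) * (d.RemV (d.bb j) (d.mC j s) (d.h j s) +
        (1 / (1 - d.bb j * (d.mC j s + d.ρO j s) * d.h j s) ^ 2 - 1 / (1 - d.bb j * d.mC j s * d.h j s) ^ 2)) *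
        (d.ρO j s - d.EO j s) ≤ d.κB j s ∧
      (∀ u ∈ Set.Icc 0 (d.h j s), ∀ w' : (Fin 4 → ℤ → ℝ), d.InBall j w' (d.SpO j s) → ∀ i k, -d.Kb ≤ k → k ≤ d.Ka →
        |(d.TP j s u + w') i k| ≤ d.M k - d.Λ j * d.δ j * d.τs * d.ω j k - d.mm) := by
  subst hd
  simp only [checkStep, Bool.and_eq_true, decide_eq_true_eq] at hS
  obtain ⟨⟨⟨⟨⟨⟨⟨⟨⟨⟨⟨⟨⟨⟨⟨⟨⟨⟨⟨⟨⟨⟨h1, h2⟩, h3⟩, h4⟩, h5⟩, h6⟩, h7⟩, h8⟩, h9⟩, h10⟩, h12⟩, h11⟩, h13⟩, h14⟩, h15⟩,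
    h16⟩, h17⟩, h18⟩, h19⟩, h20⟩, h21⟩, h22⟩, h23⟩ := hS
  have hφ0 : ∀ {a : K}, 0 ≤ a → (0 : ℝ) ≤ φ a := fun ha => by simpa using hφ ha
  have hlt1 : ∀ {a : K}, a < 1 → φ a < 1 := fun ha => by simpa using strictMono hφ ha
  simp only [toCertData_h, toCertData_Tn, toCertData_bb, toCertData_κ, toCertData_Λ, toCertData_δ, toCertData_τs,
    toCertData_mm, toCertData_mC, toCertData_EI, toCertData_E, toCertData_EO, toCertData_ρ, toCertData_ρO,
    toCertData_NCi, toCertData_mT, toCertData_SpO, toCertData_Sp, toCertData_SpI, toCertData_L1, toCertData_NV,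
    toCertData_NVh, toCertData_dP, toCertData_κB, toCertData_x, toCertData_rP, toCertData_Cm, toCertData_Ci]
  refine ⟨by simpa using strictMono hφ h1, ?_, ?_, ?_, ?_, hφ0 h6, ?_, ?_, hφ0 h9, ?_, hφ0 h11, ?_, ?_, ?_, ?_, ?_, ?_,
    ?_, ?_, ?_, ?_, ?_, ?_⟩
  · simpa [map_mul] using hlt1 h2
  · simpa [map_mul, map_add] using hlt1 h3
  · simpa [map_add] using congrArg φ h4
  · -- b5: `|TP u| ≤ mT ω` on `[0, h]`
    intro u hu
    rw [T.inBall_iff φ]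
    intro c hc
    refine (T.abs_wv_TP_le hφ j s hu.1 hu.2 hc).trans ?_
    rw [← map_mul]
    exact hφ (of_decide_eq_true ((allN_eq_true.1 h5) c hc))
  · simpa [map_mul, map_add] using hlt1 h7
  · -- b8: the `L1` clause
    have hq : φ ((T.stage j).bb * ((T.step j s).mT + (T.step j s).SpO + (T.stage j).κ) * (T.step j s).h) < 1 := hlt1 h7
    have hpos : (0 : ℝ) < (1 - φ ((T.stage j).bb * ((T.step j s).mT + (T.step j s).SpO + (T.stage j).κ) *
        (T.step j s).h)) ^ 2 := pow_pos (by linarith) 2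
    have h8' := hφ h8
    rw [map_one, map_mul, map_pow, map_sub, map_one] at h8'
    rw [div_le_iff₀ (by simpa [map_mul, map_add] using hpos)]
    simpa [map_mul, map_add] using h8'
  · -- b10: `|Vap u v| ≤ NV |v|` on `[0, h]`
    intro u hu v N hN hv
    rw [T.inBall_iff φ]
    intro r hr
    rw [T.wv_Vap φ j s u v r]
    have hvc : ∀ c < T.n, |T.wv v c| ≤ N * φ (T.wgt j c) := fun c hc => (T.inBall_iff φ j v N).1 hv c hc
    have hrow := hφ (of_decide_eq_true ((allN_eq_true.1 h10) r hr))
    rw [map_mul, sumN_eq, map_sum] at hrow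
    have hWq : ∀ q : ℕ, |T.wv (T.linR φ ((T.node j s).W.getD q []) v) r| ≤
        N * ∑ c ∈ Finset.range T.n, |φ (mget ((T.node j s).W.getD q []) r c)| * φ (T.wgt j c) := by
      intro q
      rw [T.wv_linR φ _ v hr, Finset.mul_sum]
      refine (Finset.abs_sum_le_sum_abs _ _).trans (Finset.sum_le_sum fun c hc => ?_)
      rw [abs_mul]
      calc |φ (mget ((T.node j s).W.getD q []) r c)| * |T.wv v c|
          ≤ |φ (mget ((T.node j s).W.getD q []) r c)| * (N * φ (T.wgt j c)) :=
            mul_le_mul_of_nonneg_left (hvc c (Finset.mem_range.1 hc)) (abs_nonneg _)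
        _ = N * (|φ (mget ((T.node j s).W.getD q []) r c)| * φ (T.wgt j c)) := by ring
    have hWq0 : ∀ q : ℕ,
        (0 : ℝ) ≤ N * ∑ c ∈ Finset.range T.n, |φ (mget ((T.node j s).W.getD q []) r c)| * φ (T.wgt j c) :=
      fun q => (abs_nonneg _).trans (hWq q)
    calc |∑ q ∈ Finset.range (T.pdeg + 1), T.wv (T.linR φ ((T.node j s).W.getD q []) v) r * u ^ q|
        ≤ ∑ q ∈ Finset.range (T.pdeg + 1), |T.wv (T.linR φ ((T.node j s).W.getD q []) v) r * u ^ q| :=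
          Finset.abs_sum_le_sum_abs _ _
      _ ≤ ∑ q ∈ Finset.range (T.pdeg + 1),
            (N * ∑ c ∈ Finset.range T.n, |φ (mget ((T.node j s).W.getD q []) r c)| * φ (T.wgt j c)) *
              φ (T.step j s).h ^ q := by
          refine Finset.sum_le_sum fun q _ => ?_
          rw [abs_mul, abs_pow, abs_of_nonneg hu.1]
          exact mul_le_mul (hWq q) (pow_le_pow_left₀ hu.1 hu.2 q) (pow_nonneg hu.1 q) (hWq0 q)
      _ = N * ∑ q ∈ Finset.range (T.pdeg + 1), φ ((T.step j s).h ^ q *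
            sumN T.n fun c => |mget ((T.node j s).W.getD q []) r c| * T.wgt j c) := by
          rw [Finset.mul_sum]
          refine Finset.sum_congr rfl fun q _ => ?_
          rw [map_mul, map_pow, sumN_eq, map_sum]
          have : ∀ c ∈ Finset.range T.n, φ (|mget ((T.node j s).W.getD q []) r c| * T.wgt j c) =
              |φ (mget ((T.node j s).W.getD q []) r c)| * φ (T.wgt j c) := fun c _ => by rw [map_mul, map_abs hφ]
          rw [Finset.sum_congr rfl this]; ring
      _ ≤ N * (φ (T.step j s).NV * φ (T.wgt j r)) := mul_le_mul_of_nonneg_left hrow hN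
      _ = φ (T.step j s).NV * N * φ (T.wgt j r) := by ring
  · -- b12: `|Vap h v| ≤ NVh |v|`
    intro v N hN hv
    rw [T.Vap_h_eq_linR φ, T.inBall_iff φ]
    intro r hr
    have hvc : ∀ c < T.n, |T.wv v c| ≤ N * φ (T.wgt j c) := fun c hc => (T.inBall_iff φ j v N).1 hv c hc
    have := T.abs_wv_linR_le_mul hφ h12 hN hvc hr
    rw [map_mul] at this
    exact this.trans_eq (by ring)
  · -- b13: the centre defect `dP`
    rw [T.inBall_iff φ]
    intro c hc
    have e : T.wv ((T.toCertData φ).TP j s (φ (T.step j s).h) - T.vecR φ (T.node j (s + 1)).x) c =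
        φ ((sumN (T.pdeg + 1) fun q' => vget ((T.node j s).P.getD q' []) c * (T.step j s).h ^ q') -
          vget (T.node j (s + 1)).x c) := by
      rw [map_sub, sumN_eq, map_sum]
      show T.wv ((T.toCertData φ).TP j s _) c - T.wv (T.vecR φ _) c = _
      rw [T.wv_TP φ j s _ hc, T.wv_vecR φ _ hc]
      refine congrArg₂ _ (Finset.sum_congr rfl fun q _ => by rw [map_mul, map_pow]) rfl
    rw [e, ← map_abs hφ, ← map_mul]
    exact hφ (of_decide_eq_true ((allN_eq_true.1 h13) c hc))
  · have := hφ h14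
    simp only [map_add, map_mul, map_RemK, map_RemVK, map_DevK] at this
    exact this
  · have := hφ h15
    simp only [map_add, map_mul, map_RemK, map_RemVK, map_DevK] at this
    exact this
  · have := hφ h16
    simp only [map_add, map_mul, map_RemK, map_RemVK, map_DevK] at this
    exact this
  · have := hφ h17
    simp only [map_add, map_mul, map_RemK, map_RemVK, map_DevK] at this
    exact this
  · have := hφ h18
    simp only [map_add, map_mul, map_RemK, map_RemVK, map_DevK] at this
    exact this
  · have := hφ h19
    simp only [map_add, map_mul, map_RemK, map_RemVK, map_DevK] at this
    exact this
  · have := hφ h20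
    simp only [map_add, map_mul] at this
    exact this
  · -- b21: the Lohner transport clause
    intro ξ hξ i k hk1 hk2
    have hk : -T.Kb ≤ k ∧ k ≤ T.Ka := ⟨hk1, hk2⟩
    have hc : ∀ c < T.n, |T.wv ξ c| ≤ φ (vget (T.node j s).rP c) := (T.box_iff φ _ ξ).1 hξ
    rw [T.Vap_h_eq_linR φ, ← T.linR_mulMatN φ (T.vapMat (T.node j s) (T.step j s).h) (T.node j s).Cm,
      ← T.linR_mulMatN φ (T.node j (s + 1)).Ci]
    have := T.abs_wv_linR_le hφ h21 hc (T.idx_lt_n i hk)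
    rw [T.wv_idx _ i hk] at this
    rwa [T.vecR_apply, if_pos hk]
  · -- b22: the `κB` clause
    have := hφ h22
    simp only [map_add, map_mul, map_sub, map_div₀, map_one, map_pow, map_RemVK] at this
    exact this
  · -- b23: window `M`-bounds along the sub-step
    intro u hu w' hw' i k hk1 hk2
    have hk : -T.Kb ≤ k ∧ k ≤ T.Ka := ⟨hk1, hk2⟩
    have hlt := T.idx_lt_n i hk
    have hTP := T.abs_wv_TP_le hφ j s hu.1 hu.2 hlt
    rw [T.wv_idx _ i hk] at hTP
    have hw := (T.inBall_iff φ j w' _).1 hw' _ hlt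
    rw [T.wv_idx _ i hk] at hw
    have hM := hφ (of_decide_eq_true ((allN_eq_true.1 h23) _ hlt))
    rw [map_add, map_mul, map_sub, map_sub, map_mul, map_mul, map_mul] at hM
    rw [T.M_of_InW φ i hk, T.omega_of_InW φ j i hk, Pi.add_apply]
    calc |(T.toCertData φ).TP j s u i k + w' i k| ≤ |(T.toCertData φ).TP j s u i k| + |w' i k| := abs_add_le _ _
      _ ≤ _ := by linarith

end Step

end CertTables

end Summit.NavierStokesRegularity.NavierStokesRegularity.Theorems.TaylorModelCert
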